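import Summits.Ventures.YMGap.RobustBall.PerturbedLimitStates
import Summits.Ventures.YMGap.RobustBall.TorusRowsSU2StarW
import Mathlib.Probability.Moments.Covariance
import HarnessLib

/-!
# Venture YMGap, track ROBUST-BALL (Y2) — crux Y2-X2-W, step W9: torus clustering uniform in `L` ⇒ EXPONENTIAL CLUSTERING OF
# EVERY INFINITE-VOLUME LIMIT STATE of a member family (the `ℤ^d` reading of the torus currencies, tiers 1 and 2)

HONEST FRAMING. WHAT THIS IS: a venture file (cell `pub-ymgap`, track Y2 ROBUST-BALL, seat ds-2): the glue between the cell's TORUS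
clustering currencies (`ClustersWith W β A m`, hence `TorusClusteringOnBall` / `TorusClusteringOnBallW`, constants uniform in the torus side)
and the INFINITE-VOLUME limit states of rb-p2's `perturbedLimitPoints β 𝓦` (subsequential limits on `SU(N)^{edges(ℤ^d)}` of the perturbed torus
states of a family `𝓦 = (W_L)_L`, one member per torus size; non-empty for every family by Prokhorov, `perturbedLimitPoints_nonempty`):
* `limitState_abs_cov_le_of_clustersWith` — if `ClustersWith (𝓦 L) β A m` for all large `L`, then EVERY limit state `μ` clusters with the SAME
  constants: for bounded continuous cylinder observables `f, g` on `ℤ^d` with link supports `Δf, Δg` at sup-distance `≥ n` and per-link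
  `suFrobDist`-Lipschitz vectors `δf, δg`, `|cov_μ(f, g)| ≤ A (Σ δg)(Σ δf) e^{−m n}` (the torus observables `f ∘ torusLift`, their transported
  supports / Lipschitz vectors, `torusNorm_proj_eq` below half the period, Mathlib `covariance_map`, and the weak limit);
* `limitState_abs_cov_le_onBallW` / `…_onBall` — the same from the currencies `TorusClusteringOnBallW` (tier 2) / `TorusClusteringOnBall`
  (tier 1) for a family EVENTUALLY IN THE BALL;
* `su2_limitState_clustering_starW_oneQuarter_t100` — example: SU(2), d = 4, β_W = 1/4, EVERY limit state of EVERY family eventually in the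
  weighted ball `ClusterDomain κ (27/250) (27/500)` (`κ ≥ 1/100`) clusters at rate `1/100` (weighted robust star door, `TorusRowsSU2StarW`).
WHAT THIS IS NOT: no DLR statement and no uniqueness for the limit states (the tier-2 `ℤ^d` uniqueness half is not claimed anywhere); lattice
strong-coupling bookkeeping — nothing about the continuum or the Millennium problem.

## References
* E. Seiler, LNP 159 (1982) Ch. 2 (torus states and their limits); the tree: `PerturbedLimitStates.lean` (rb-p2), `Defs.lean` (`ClustersWith`),
  `TorusPlaquetteNeighbours.lean` (`torusNorm_proj_eq`), `DobrushinComparisonMetric.lean` (`abs_sub_le_sum_of_dependsOn`).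
-/

noncomputable section

open MeasureTheory ProbabilityTheory Filter Topology Function Finset
open Literature.Probability.LatticeModels (Site Torus.proj)
open Literature.Probability.LatticeModels.DobrushinMetric
open Literature.MathematicalPhysics.QuantumLattice hiding torusNorm
open Literature.MathematicalPhysics.QuantumFieldTheory hiding ZdEdge Site

namespace Summit.Ventures.YMGap.RobustBall

variable {d N : ℕ}

/-! ### Transport of cylinder observables to the torus -/

section Transport

variable {G : Type*}

/-- The torus restriction of a cylinder observable reads only the torus links below its support. [folklore] -/
theorem dependsOn_toTorusObservable {α : Type*} (L : ℕ) {F : LGConfig d G → α} {Δ : Finset (ZdEdge d)}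
    (hF : IsCylinder F Δ) [DecidableEq (Edge d L)] :
    DependsOn (toTorusObservable L F) (↑(Δ.image (torusEdge L)) : Set (Edge d L)) := by
  intro U V hUV
  simp only [toTorusObservable_apply]
  refine hF fun e he => ?_
  show U (torusEdge L e) = V (torusEdge L e)
  exact hUV (torusEdge L e) (Finset.mem_coe.2 (Finset.mem_image_of_mem _ he))

/-- **Transported Lipschitz vector.** If `F` is a cylinder observable on `Δ` with per-link Lipschitz vector `δ` for a weight `r`
vanishing on the diagonal, its torus restriction has the Lipschitz vector `ē ↦ Σ_{x ∈ Δ, x̄ = ē} δ x` (fibre sums). [folklore] -/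
theorem isLipBound_toTorusObservable (L : ℕ) {r : G → G → ℝ} (hr0 : ∀ a, r a a = 0) {F : LGConfig d G → ℝ}
    {Δ : Finset (ZdEdge d)} {δ : ZdEdge d → ℝ} (hF : IsCylinder F Δ) (hδ : IsLipBound r F δ) [DecidableEq (Edge d L)] :
    IsLipBound r (toTorusObservable L F) fun ē => ∑ x ∈ Δ.filter (fun x => torusEdge L x = ē), δ x := by
  classical
  refine ⟨fun ē => Finset.sum_nonneg fun x _ => hδ.nonneg x, fun ē U V hUV => ?_⟩
  have h := abs_sub_le_sum_of_dependsOn (r := r) hF hδ (torusLift L U) (torusLift L V)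
  simp only [toTorusObservable_apply]
  refine h.trans (le_of_eq ?_)
  rw [Finset.sum_filter, Finset.sum_mul]
  refine Finset.sum_congr rfl fun x _ => ?_
  have hU : torusLift L U x = U (torusEdge L x) := rfl
  have hV : torusLift L V x = V (torusEdge L x) := rfl
  rw [hU, hV]
  split_ifs with hx
  · rw [hx]
  · rw [hUV _ hx, hr0, mul_zero, zero_mul]

/-- The fibre sums add up to the original Lipschitz sum. [folklore] -/
theorem sum_image_fibre_eq (L : ℕ) (Δ : Finset (ZdEdge d)) (δ : ZdEdge d → ℝ) [DecidableEq (Edge d L)] :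
    ∑ ē ∈ Δ.image (torusEdge L), ∑ x ∈ Δ.filter (fun x => torusEdge L x = ē), δ x = ∑ x ∈ Δ, δ x :=
  Finset.sum_fiberwise_of_maps_to (fun _ hx => Finset.mem_image_of_mem _ hx) δ

/-- **Distances survive below half the period**: if `n ≤ ‖x − y‖_∞` and `2‖x − y‖_∞ < L` then the torus links below `x, y` are at
periodic sup-distance `≥ n`. [folklore] -/
theorem le_torusNorm_torusEdge_sub {L : ℕ} [NeZero L] {x y : ZdEdge d} {n : ℕ}
    (hn : n ≤ Literature.Probability.LatticeModels.Site.supNorm (x.1 - y.1))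
    (hL : 2 * Literature.Probability.LatticeModels.Site.supNorm (x.1 - y.1) < L) :
    n ≤ torusNorm ((torusEdge L x).1 - (torusEdge L y).1) := by
  have h1 : (torusEdge L x).1 - (torusEdge L y).1 = Torus.proj L (x.1 - y.1) := by
    funext i
    simp [torusEdge, Torus.proj, Int.cast_sub]
  rw [h1, torusNorm_proj_eq hL]
  exact hn

end Transport

/-! ### Torus clustering, uniform in `L`, passes to every limit state -/

section Limit

/-- The member's torus covariance of two transported observables, written with the member's expectations. [folklore] -/
theorem expectation_mul_sub_eq_cov {L : ℕ} [NeZero L] (W : Perturbation d L N) (β : ℝ) {f g : LGConfig d (SUN N) → ℝ}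
    (hfm : Measurable f) (hgm : Measurable g) {Mf Mg : ℝ} (hMf : ∀ U, |f U| ≤ Mf) (hMg : ∀ U, |g U| ≤ Mg) :
    W.expectation (fundamentalRep (Fin N)) β (toTorusObservable L fun U => f U * g U) -
        W.expectation (fundamentalRep (Fin N)) β (toTorusObservable L f) *
          W.expectation (fundamentalRep (Fin N)) β (toTorusObservable L g) =
      cov[toTorusObservable L f, toTorusObservable L g; W.perturbedMeasure (fundamentalRep (Fin N)) β] := by
  haveI : IsProbabilityMeasure (W.perturbedMeasure (fundamentalRep (Fin N)) β) := isProbabilityMeasure_perturbedMeasure W β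
  have hfTm : Measurable (toTorusObservable L f) := hfm.comp (measurable_torusLift L)
  have hgTm : Measurable (toTorusObservable L g) := hgm.comp (measurable_torusLift L)
  rw [covariance_eq_sub]
  · rfl
  · exact memLp_of_bounded (a := -Mf) (b := Mf) (ae_of_all _ fun U => abs_le.1 (hMf _)) hfTm.aestronglyMeasurable 2
  · exact memLp_of_bounded (a := -Mg) (b := Mg) (ae_of_all _ fun U => abs_le.1 (hMg _)) hgTm.aestronglyMeasurable 2

/-- **One torus**: a member clustering with `(A, m)` on a torus of side `L > 2·diam` bounds the covariance of two transported cylinder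
observables whose `ℤ^d` supports are at sup-distance `≥ n` (and all of whose mutual distances are `< L/2`). [folklore] -/
theorem abs_cov_toTorusObservable_le {L : ℕ} [NeZero L] {W : Perturbation d L N} {β A m : ℝ} (hW : ClustersWith W β A m)
    {f g : LGConfig d (SUN N) → ℝ} {Δf Δg : Finset (ZdEdge d)} {δf δg : ZdEdge d → ℝ} {n : ℕ}
    (hfm : Measurable f) (hgm : Measurable g) (hfdep : IsCylinder f Δf) (hgdep : IsCylinder g Δg)
    (hfb : ∃ M, ∀ U, |f U| ≤ M) (hgb : ∃ M, ∀ U, |g U| ≤ M)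
    (hflip : IsLipBound suFrobDist f δf) (hglip : IsLipBound suFrobDist g δg)
    (hdist : ∀ x ∈ Δf, ∀ y ∈ Δg, n ≤ Literature.Probability.LatticeModels.Site.supNorm (x.1 - y.1))
    (hL : ∀ x ∈ Δf, ∀ y ∈ Δg, 2 * Literature.Probability.LatticeModels.Site.supNorm (x.1 - y.1) < L) :
    |cov[toTorusObservable L f, toTorusObservable L g; W.perturbedMeasure (fundamentalRep (Fin N)) β]| ≤
      A * (∑ y ∈ Δg, δg y) * (∑ x ∈ Δf, δf x) * Real.exp (-m * n) := by
  classical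
  obtain ⟨Mf, hMf⟩ := hfb
  obtain ⟨Mg, hMg⟩ := hgb
  have key := hW (toTorusObservable L f) (toTorusObservable L g) (Δf.image (torusEdge L)) (Δg.image (torusEdge L))
    (fun ē => ∑ x ∈ Δf.filter (fun x => torusEdge L x = ē), δf x)
    (fun ē => ∑ x ∈ Δg.filter (fun x => torusEdge L x = ē), δg x) n
    (hfm.comp (measurable_torusLift L)) (hgm.comp (measurable_torusLift L))
    (dependsOn_toTorusObservable L hfdep) (dependsOn_toTorusObservable L hgdep) ⟨Mf, fun U => hMf _⟩ ⟨Mg, fun U => hMg _⟩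
    (isLipBound_toTorusObservable L suFrobDist_self hfdep hflip)
    (isLipBound_toTorusObservable L suFrobDist_self hgdep hglip) (fun xb hxb yb hyb => by
      obtain ⟨x, hx, rfl⟩ := Finset.mem_image.1 hxb
      obtain ⟨y, hy, rfl⟩ := Finset.mem_image.1 hyb
      exact le_torusNorm_torusEdge_sub (hdist x hx y hy) (hL x hx y hy))
  rw [sum_image_fibre_eq, sum_image_fibre_eq] at key
  exact key

/-- **TORUS CLUSTERING UNIFORM IN `L` ⇒ CLUSTERING OF EVERY INFINITE-VOLUME LIMIT STATE.** Let the members of the family `𝓦` cluster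
on all large tori with the same constants, `ClustersWith (𝓦 L) β A m` for `L ≥ L₀`. Then every `μ ∈ perturbedLimitPoints β 𝓦` satisfies,
for bounded continuous (and measurable) cylinder observables `f, g` with link supports `Δf, Δg` at sup-distance `≥ n` and per-link
`suFrobDist`-Lipschitz vectors `δf, δg`: `|cov_μ(f, g)| ≤ A (Σ_{Δg} δg)(Σ_{Δf} δf) e^{−m n}`. [folklore] -/
theorem limitState_abs_cov_le_of_clustersWith {β A m : ℝ} {𝓦 : PerturbationFamily d N}
    (hcl : ∀ᶠ L in atTop, ClustersWith (𝓦 L) β A m) {μ : Measure (LGConfig d (SUN N))}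
    (hμ : μ ∈ perturbedLimitPoints β 𝓦) {f g : LGConfig d (SUN N) → ℝ} {Δf Δg : Finset (ZdEdge d)}
    {δf δg : ZdEdge d → ℝ} {n : ℕ} (hfm : Measurable f) (hgm : Measurable g) (hfc : Continuous f) (hgc : Continuous g)
    (hfdep : IsCylinder f Δf) (hgdep : IsCylinder g Δg) (hfb : ∃ M, ∀ U, |f U| ≤ M) (hgb : ∃ M, ∀ U, |g U| ≤ M)
    (hflip : IsLipBound suFrobDist f δf) (hglip : IsLipBound suFrobDist g δg)
    (hdist : ∀ x ∈ Δf, ∀ y ∈ Δg, n ≤ Literature.Probability.LatticeModels.Site.supNorm (x.1 - y.1)) :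
    |cov[f, g; μ]| ≤ A * (∑ y ∈ Δg, δg y) * (∑ x ∈ Δf, δf x) * Real.exp (-m * n) := by
  obtain ⟨Ls, hmono, hprob, hlim⟩ := hμ
  obtain ⟨Mf, hMf⟩ := hfb
  obtain ⟨Mg, hMg⟩ := hgb
  haveI := hprob
  -- the three expectations converge
  have hfg_cyl : IsCylinder (fun U => f U * g U) (Δf ∪ Δg) :=
    Literature.MathematicalPhysics.QuantumFieldTheory.IsCylinder.mul hfdep hgdep
  have hfg_b : ∃ M, ∀ U, |f U * g U| ≤ M :=
    ⟨Mf * Mg, fun U => by rw [abs_mul]; exact mul_le_mul (hMf U) (hMg U) (abs_nonneg _) ((abs_nonneg _).trans (hMf U))⟩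
  have tf := hlim f Δf hfdep hfc ⟨Mf, hMf⟩
  have tg := hlim g Δg hgdep hgc ⟨Mg, hMg⟩
  have tfg := hlim (fun U => f U * g U) (Δf ∪ Δg) hfg_cyl (hfc.mul hgc) hfg_b
  -- the limit covariance
  have hcovμ : cov[f, g; μ] = ∫ U, f U * g U ∂μ - (∫ U, f U ∂μ) * ∫ U, g U ∂μ := by
    rw [covariance_eq_sub]
    · rfl
    · exact memLp_of_bounded (a := -Mf) (b := Mf) (ae_of_all _ fun U => abs_le.1 (hMf U)) hfm.aestronglyMeasurable 2
    · exact memLp_of_bounded (a := -Mg) (b := Mg) (ae_of_all _ fun U => abs_le.1 (hMg U)) hgm.aestronglyMeasurable 2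
  have tcov : Tendsto (fun k =>
      (𝓦 (Ls k)).expectation (fundamentalRep (Fin N)) β (toTorusObservable (Ls k + 1) fun U => f U * g U) -
        (𝓦 (Ls k)).expectation (fundamentalRep (Fin N)) β (toTorusObservable (Ls k + 1) f) *
          (𝓦 (Ls k)).expectation (fundamentalRep (Fin N)) β (toTorusObservable (Ls k + 1) g))
      atTop (𝓝 (cov[f, g; μ])) := by
    rw [hcovμ]
    exact tfg.sub (tf.mul tg)
  -- eventually the torus covariance is bounded by the `ClustersWith` constants
  have hLs : Tendsto Ls atTop atTop := hmono.tendsto_atTop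
  have hpairs : ∀ᶠ k in atTop, ∀ x ∈ Δf, ∀ y ∈ Δg,
      2 * Literature.Probability.LatticeModels.Site.supNorm (x.1 - y.1) < Ls k + 1 := by
    refine (Filter.eventually_all_finset Δf).2 fun x _ => (Filter.eventually_all_finset Δg).2 fun y _ => ?_
    filter_upwards [hLs.eventually
      (eventually_gt_atTop (2 * Literature.Probability.LatticeModels.Site.supNorm (x.1 - y.1)))] with k hk
    exact Nat.lt_succ_of_lt hk
  have hev : ∀ᶠ k in atTop,
      |(𝓦 (Ls k)).expectation (fundamentalRep (Fin N)) β (toTorusObservable (Ls k + 1) fun U => f U * g U) -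
        (𝓦 (Ls k)).expectation (fundamentalRep (Fin N)) β (toTorusObservable (Ls k + 1) f) *
          (𝓦 (Ls k)).expectation (fundamentalRep (Fin N)) β (toTorusObservable (Ls k + 1) g)| ≤
        A * (∑ y ∈ Δg, δg y) * (∑ x ∈ Δf, δf x) * Real.exp (-m * n) := by
    filter_upwards [hLs.eventually hcl, hpairs] with k hk hkD
    rw [expectation_mul_sub_eq_cov (𝓦 (Ls k)) β hfm hgm hMf hMg]
    exact abs_cov_toTorusObservable_le hk hfm hgm hfdep hgdep ⟨Mf, hMf⟩ ⟨Mg, hMg⟩ hflip hglip hdist hkD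
  exact le_of_tendsto tcov.abs hev

/-- **Every limit state of a family eventually in the TIER-2 ball clusters** (from the currency `TorusClusteringOnBallW`). [folklore] -/
theorem limitState_abs_cov_le_onBallW {β κ ε₀ ε₁ A m : ℝ} (h : TorusClusteringOnBallW N d β κ ε₀ ε₁ A m)
    {𝓦 : PerturbationFamily d N} (hW : ∀ᶠ L in atTop, 𝓦 L ∈ ClusterDomain κ ε₀ ε₁) {μ : Measure (LGConfig d (SUN N))}
    (hμ : μ ∈ perturbedLimitPoints β 𝓦) {f g : LGConfig d (SUN N) → ℝ} {Δf Δg : Finset (ZdEdge d)}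
    {δf δg : ZdEdge d → ℝ} {n : ℕ} (hfm : Measurable f) (hgm : Measurable g) (hfc : Continuous f) (hgc : Continuous g)
    (hfdep : IsCylinder f Δf) (hgdep : IsCylinder g Δg) (hfb : ∃ M, ∀ U, |f U| ≤ M) (hgb : ∃ M, ∀ U, |g U| ≤ M)
    (hflip : IsLipBound suFrobDist f δf) (hglip : IsLipBound suFrobDist g δg)
    (hdist : ∀ x ∈ Δf, ∀ y ∈ Δg, n ≤ Literature.Probability.LatticeModels.Site.supNorm (x.1 - y.1)) :
    |cov[f, g; μ]| ≤ A * (∑ y ∈ Δg, δg y) * (∑ x ∈ Δf, δf x) * Real.exp (-m * n) := by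
  refine limitState_abs_cov_le_of_clustersWith ?_ hμ hfm hgm hfc hgc hfdep hgdep hfb hgb hflip hglip hdist
  filter_upwards [hW, eventually_ge_atTop 2] with L hL hL2
  exact h (L + 1) (by omega) (𝓦 L) hL

/-- **Every limit state of a family eventually in the TIER-1 ball clusters** (from the currency `TorusClusteringOnBall`). [folklore] -/
theorem limitState_abs_cov_le_onBall {β ε₀ ε₁ A m : ℝ} {r : ℕ} (h : TorusClusteringOnBall N d β ε₀ ε₁ r A m)
    {𝓦 : PerturbationFamily d N} (hW : ∀ᶠ L in atTop, 𝓦 L ∈ ClusterDomainFR ε₀ ε₁ r) {μ : Measure (LGConfig d (SUN N))}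
    (hμ : μ ∈ perturbedLimitPoints β 𝓦) {f g : LGConfig d (SUN N) → ℝ} {Δf Δg : Finset (ZdEdge d)}
    {δf δg : ZdEdge d → ℝ} {n : ℕ} (hfm : Measurable f) (hgm : Measurable g) (hfc : Continuous f) (hgc : Continuous g)
    (hfdep : IsCylinder f Δf) (hgdep : IsCylinder g Δg) (hfb : ∃ M, ∀ U, |f U| ≤ M) (hgb : ∃ M, ∀ U, |g U| ≤ M)
    (hflip : IsLipBound suFrobDist f δf) (hglip : IsLipBound suFrobDist g δg)
    (hdist : ∀ x ∈ Δf, ∀ y ∈ Δg, n ≤ Literature.Probability.LatticeModels.Site.supNorm (x.1 - y.1)) :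
    |cov[f, g; μ]| ≤ A * (∑ y ∈ Δg, δg y) * (∑ x ∈ Δf, δf x) * Real.exp (-m * n) := by
  refine limitState_abs_cov_le_of_clustersWith ?_ hμ hfm hgm hfc hgc hfdep hgdep hfb hgb hflip hglip hdist
  filter_upwards [hW, eventually_ge_atTop 2] with L hL hL2
  exact h (L + 1) (by omega) (𝓦 L) hL

/-- **EXAMPLE ROW ON `ℤ⁴`**, `SU(2)`, `β_W = 1/4` (tree `β = 1/8`), WEIGHTED ROBUST STAR DOOR: for every weight `κ ≥ 1/100`, every family
eventually in the tier-2 ball `ClusterDomain κ (27/250) (27/500)`, and EVERY infinite-volume limit state `μ` of its perturbed torus states,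
the covariances of bounded continuous cylinder observables decay at rate `1/100` per lattice unit: `|cov_μ(f,g)| ≤ 16e^{1/50}(Σδg)(Σδf)e^{−n/100}`.
HYPOTHESIS-FREE. [folklore] -/
theorem su2_limitState_clustering_starW_oneQuarter_t100 {κ : ℝ} (hκ : 1 / 100 ≤ κ) {𝓦 : PerturbationFamily 4 2}
    (hW : ∀ᶠ L in atTop, 𝓦 L ∈ ClusterDomain κ (27 / 250) (27 / 500)) {μ : Measure (LGConfig 4 (SUN 2))}
    (hμ : μ ∈ perturbedLimitPoints (1 / 8) 𝓦) {f g : LGConfig 4 (SUN 2) → ℝ} {Δf Δg : Finset (ZdEdge 4)}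
    {δf δg : ZdEdge 4 → ℝ} {n : ℕ} (hfm : Measurable f) (hgm : Measurable g) (hfc : Continuous f) (hgc : Continuous g)
    (hfdep : IsCylinder f Δf) (hgdep : IsCylinder g Δg) (hfb : ∃ M, ∀ U, |f U| ≤ M) (hgb : ∃ M, ∀ U, |g U| ≤ M)
    (hflip : IsLipBound suFrobDist f δf) (hglip : IsLipBound suFrobDist g δg)
    (hdist : ∀ x ∈ Δf, ∀ y ∈ Δg, n ≤ Literature.Probability.LatticeModels.Site.supNorm (x.1 - y.1)) :
    |cov[f, g; μ]| ≤ 16 * Real.exp (1 / 50) * (∑ y ∈ Δg, δg y) * (∑ x ∈ Δf, δf x) * Real.exp (-(1 / 100) * n) :=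
  limitState_abs_cov_le_onBallW (su2_torusClusteringOnBallW_star_oneQuarter_t100 κ hκ (1 / 8) (by norm_num) le_rfl) hW hμ
    hfm hgm hfc hgc hfdep hgdep hfb hgb hflip hglip hdist

end Limit

end Summit.Ventures.YMGap.RobustBall

end
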